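import Summits.KontsevichZagierPeriods.KontsevichZagierPeriods.Theorems.OctahedralSymmetryZhaoRelationInKZDefs
import Summits.KontsevichZagierPeriods.KontsevichZagierPeriods.Theorems.MzvKernelInKZ.Negative.ScalingDivision
import Literature.NumberTheory.Transcendental.KZGroundingRelations
import Literature.NumberTheory.Transcendental.KZSubcalculusInvariants
import Summits.KontsevichZagierPeriods.KontsevichZagierPeriods.Theorems.OctahedralSymmetryOctahedralInvolutionMove
import Summits.KontsevichZagierPeriods.KontsevichZagierPeriods.Theorems.OctahedralSymmetrySimplexDilationMove
import Summits.KontsevichZagierPeriods.KontsevichZagierPeriods.Theorems.FurushoPentagonHoffmanRelationInKZCubicalTransportAux2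
import Literature.NumberTheory.Transcendental.KZLogCalculusProofs

-- ===== inlined from OctahedralSymmetryZhaoRelationInKZCommon.lean =====

/-!
# `ZhaoRelationInKZ` (stmt-KontsevichZagierPeriods-9433), line `Sketch`: common lemmas

Companion proof file of `OctahedralSymmetryZhaoRelationInKZDefs.lean` (theorems only):

* the elementary API of the canonical representations `repRe/repIm/rep`, of the classes `Z b W`,
  `ZP b b' U V` (`ZP = Z * Z` by `KZ.of_mul_of`), and of `evalRow` (additivity, scaling);
* **soundness of the certificate checker**: `certCheck X rows N T = true` and
  `evalRow ρ ∈ KZ.relations` for every row give `N • evalRow T ∈ KZ.relations`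
  (`certCheck_sound`) — pure bookkeeping in the free abelian group `KZ.FormalRep`;
* the low-dimensional descriptions of the domains (`KZ.openOrderedSimplex 1, 2, 3`, the product
  domain `(0,1) × Δ₂`) in the literal shapes used by the route's statements;
* iterated integrand additivity with INTEGER coefficients (`of_sub_sum_zsmul_mem_relations`),
  the form in which every engine of the line delivers its rows.

References: M. Kontsevich, D. Zagier, *Periods* (2001), §1.2 (rule (1)).
-/

noncomputable section

open Set MeasureTheory
open Literature.NumberTheory.Transcendental Literature.NumberTheory.Transcendental.KZ

namespace Summit.KontsevichZagierPeriods.OctahedralSymmetry.ZhaoRelationInKZ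

/-! ## The canonical representations -/

/-- The domain of `repRe W`. [folklore] -/
@[simp] theorem repRe_domain (W : List (Fin 5)) (h : LevelFour.IsConvergent W) :
    (repRe W h).domain = openOrderedSimplex W.length := rfl

/-- The domain of `repIm W`. [folklore] -/
@[simp] theorem repIm_domain (W : List (Fin 5)) (h : LevelFour.IsConvergent W) :
    (repIm W h).domain = openOrderedSimplex W.length := rfl

/-- The integrand of `repRe W` is the real part of the complex word integrand. [folklore] -/
@[simp] theorem repRe_integrand (W : List (Fin 5)) (h : LevelFour.IsConvergent W) :
    (repRe W h).integrand = levelFourIntegrandRe W := rfl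

/-- The integrand of `repIm W` is the imaginary part of the complex word integrand. [folklore] -/
@[simp] theorem repIm_integrand (W : List (Fin 5)) (h : LevelFour.IsConvergent W) :
    (repIm W h).integrand = levelFourIntegrandIm W := rfl

/-- `rep false = repRe`. [folklore] -/
@[simp] theorem rep_false (W : List (Fin 5)) (h : LevelFour.IsConvergent W) :
    rep false W h = repRe W h := rfl

/-- `rep true = repIm`. [folklore] -/
@[simp] theorem rep_true (W : List (Fin 5)) (h : LevelFour.IsConvergent W) :
    rep true W h = repIm W h := rfl

/-- The domain of `rep b W` is the open ordered simplex. [folklore] -/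
@[simp] theorem rep_domain (b : Bool) (W : List (Fin 5)) (h : LevelFour.IsConvergent W) :
    (rep b W h).domain = openOrderedSimplex W.length := by
  cases b <;> rfl

/-- The integrand of `rep false W` at a point. [folklore] -/
theorem rep_false_integrand_apply (W : List (Fin 5)) (h : LevelFour.IsConvergent W)
    (t : Fin W.length → ℝ) : (rep false W h).integrand t = (levelFourIntegrandC W t).re := rfl

/-- The integrand of `rep true W` at a point. [folklore] -/
theorem rep_true_integrand_apply (W : List (Fin 5)) (h : LevelFour.IsConvergent W)
    (t : Fin W.length → ℝ) : (rep true W h).integrand t = (levelFourIntegrandC W t).im := rfl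

/-- `Z b W` is the class of `rep b W` for a convergent word. [folklore] -/
theorem Z_eq_of (b : Bool) (W : List (Fin 5)) (h : LevelFour.IsConvergent W) :
    Z b W = of (rep b W h) := by
  simp [Z, h]

/-- `Z b W = 0` for a non-convergent word. [folklore] -/
theorem Z_eq_zero (b : Bool) (W : List (Fin 5)) (h : ¬ LevelFour.IsConvergent W) :
    Z b W = 0 := by
  simp [Z, h]

/-- `ZP b b' U V` is the class of the product representation for convergent words. [folklore] -/
theorem ZP_eq_of (b b' : Bool) (U V : List (Fin 5)) (hU : LevelFour.IsConvergent U)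
    (hV : LevelFour.IsConvergent V) : ZP b b' U V = of ((rep b U hU).prod (rep b' V hV)) := by
  simp [ZP, hU, hV]

/-- **`ZP = Z * Z`** (the product in `KZ.FormalRep` of two classes is the class of the Fubini
product, `KZ.of_mul_of`; both sides vanish when a word is not convergent).
[cite: KontsevichZagier2001, §4.1] -/
theorem ZP_eq_mul (b b' : Bool) (U V : List (Fin 5)) : ZP b b' U V = Z b U * Z b' V := by
  by_cases hU : LevelFour.IsConvergent U
  · by_cases hV : LevelFour.IsConvergent V
    · rw [ZP_eq_of b b' U V hU hV, Z_eq_of b U hU, Z_eq_of b' V hV, of_mul_of]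
    · simp [ZP, Z, hU, hV]
  · simp [ZP, Z, hU]

/-! ## `evalRow`: additivity, scaling, and soundness of the checker -/

/-- `evalRow [] = 0`. [folklore] -/
@[simp] theorem evalRow_nil : evalRow [] = 0 := rfl

/-- `evalRow` of a cons. [folklore] -/
@[simp] theorem evalRow_cons (p : Sym × ℤ) (ρ : Row) :
    evalRow (p :: ρ) = p.2 • Z p.1.1 p.1.2 + evalRow ρ := by
  simp [evalRow]

/-- `evalRow` is additive under concatenation. [folklore] -/
theorem evalRow_append (ρ₁ ρ₂ : Row) : evalRow (ρ₁ ++ ρ₂) = evalRow ρ₁ + evalRow ρ₂ := by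
  induction ρ₁ with
  | nil => simp
  | cons p ρ ih => simp [ih, add_assoc]

/-- `evalRow (scaleRow N ρ) = N • evalRow ρ`. [folklore] -/
theorem evalRow_scaleRow (N : ℤ) (ρ : Row) : evalRow (scaleRow N ρ) = N • evalRow ρ := by
  induction ρ with
  | nil => simp [scaleRow]
  | cons p ρ ih =>
    simp only [scaleRow, List.map_cons] at ih ⊢
    rw [evalRow_cons, evalRow_cons, ih, smul_add, mul_smul]

/-- The real-part row of a term list evaluates to `Σ c • Z false W`. [folklore] -/
theorem evalRow_re (L : List (ℤ × List (Fin 5))) :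
    evalRow (Row.re L) = (L.map fun p => p.1 • Z false p.2).sum := by
  induction L with
  | nil => rfl
  | cons p L ih =>
    simp only [Row.re, List.map_cons, List.sum_cons] at ih ⊢
    rw [evalRow_cons, ih]

/-- The imaginary-part row of a term list evaluates to `Σ c • Z true W`. [folklore] -/
theorem evalRow_im (L : List (ℤ × List (Fin 5))) :
    evalRow (Row.im L) = (L.map fun p => p.1 • Z true p.2).sum := by
  induction L with
  | nil => rfl
  | cons p L ih =>
    simp only [Row.im, List.map_cons, List.sum_cons] at ih ⊢
    rw [evalRow_cons, ih]

/-- Adding into a bucket list adds the corresponding multiple of the class. [folklore] -/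
theorem evalRow_addTo (acc : Row) (s : Sym) (c : ℤ) :
    evalRow (addTo acc s c) = evalRow acc + c • Z s.1 s.2 := by
  induction acc with
  | nil => simp [addTo]
  | cons p acc ih =>
    obtain ⟨s', c'⟩ := p
    by_cases h : s' = s
    · subst h
      simp only [addTo, if_true, evalRow_cons, add_smul]
      abel
    · simp only [addTo, if_neg h, evalRow_cons, ih]
      abel

/-- Collecting a row into buckets does not change its evaluation. [folklore] -/
theorem evalRow_collect (ρ : Row) : evalRow (collect ρ) = evalRow ρ := by
  induction ρ with
  | nil => rfl
  | cons p ρ ih =>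
    obtain ⟨s, c⟩ := p
    simp only [collect, evalRow_addTo, ih, evalRow_cons]
    abel

/-- A bucket list all of whose coefficients vanish evaluates to `0`. [folklore] -/
theorem evalRow_eq_zero_of_all (ρ : Row) (h : (ρ.all fun p => p.2 == 0) = true) :
    evalRow ρ = 0 := by
  induction ρ with
  | nil => rfl
  | cons p ρ ih =>
    simp only [List.all_cons, Bool.and_eq_true, beq_iff_eq] at h
    rw [evalRow_cons, h.1, zero_smul, zero_add, ih h.2]

/-- **A certified-zero row evaluates to zero.** [folklore] -/
theorem evalRow_eq_zero_of_isZeroRow (ρ : Row) (h : isZeroRow ρ = true) : evalRow ρ = 0 := by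
  rw [← evalRow_collect]
  exact evalRow_eq_zero_of_all _ h

/-- A linear combination of rows that are relations is a relation. [folklore] -/
theorem evalRow_lincomb_mem (X : List ℤ) (rows : List Row)
    (h : ∀ ρ ∈ rows, evalRow ρ ∈ relations) : evalRow (lincomb X rows) ∈ relations := by
  induction rows generalizing X with
  | nil => cases X <;> simp [lincomb, relations.zero_mem]
  | cons ρ rows ih =>
    cases X with
    | nil => simp [lincomb, relations.zero_mem]
    | cons x X =>
      simp only [lincomb, evalRow_append, evalRow_scaleRow]
      exact relations.add_mem (relations.zsmul_mem (h ρ (by simp)) x)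
        (ih X fun ρ' hρ' => h ρ' (by simp [hρ']))

/-- **Soundness of the certificate checker.** If `Σⱼ Xⱼ ρⱼ − N·T` collects to the zero row and
every `ρⱼ` evaluates into `KZ.relations`, then `N • evalRow T ∈ KZ.relations`. [folklore] -/
theorem certCheck_sound (X : List ℤ) (rows : List Row) (N : ℤ) (T : Row)
    (hc : certCheck X rows N T = true) (h : ∀ ρ ∈ rows, evalRow ρ ∈ relations) :
    N • evalRow T ∈ relations := by
  have h0 := evalRow_eq_zero_of_isZeroRow _ hc
  rw [evalRow_append, evalRow_scaleRow, neg_smul, ← sub_eq_add_neg, sub_eq_zero] at h0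
  rw [← h0]
  exact evalRow_lincomb_mem X rows h

/-- **Integer division** (route item `IntegerDivision`, proved in the tree): a positive integer
multiple of `c` is a relation only if `c` is. [cite: KontsevichZagier2001, §1.2] -/
theorem mem_relations_of_zsmul_mem {c : FormalRep} {N : ℤ} (hN : 0 < N)
    (h : N • c ∈ relations) : c ∈ relations := by
  obtain ⟨n, rfl⟩ := Int.eq_ofNat_of_zero_le hN.le
  have hn : 0 < n := by exact_mod_cast hN
  exact Summit.KontsevichZagierPeriods.MzvKernelInKZ.Negative.mem_relations_of_nsmul_mem hn
    (by simpa using h)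

/-! ## Iterated integrand additivity with integer coefficients -/

/-- The class of an integer multiple of an integrand is the integer multiple of the class:
`[σ, k f] − k • [σ, f] ∈ relations` (`k : ℤ`; rule (1b) iterated, via
`KZ.IntegralRep.of_constMul_nat_sub_nsmul_mem_relations` and one sign flip).
[cite: KontsevichZagier2001, §1.2 rule (1)] -/
theorem of_constMul_int_sub_zsmul_mem_relations {n : ℕ} (r : IntegralRep n) (k : ℤ) :
    of (r.constMul (k : ℝ) (isAlgebraic_int k)) - k • of r ∈ relations := by
  rcases Int.eq_nat_or_neg k with ⟨m, rfl | rfl⟩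
  · have h := IntegralRep.of_constMul_nat_sub_nsmul_mem_relations r m
    have e : r.constMul ((m : ℤ) : ℝ) (isAlgebraic_int (m : ℤ)) = r.constMul (m : ℝ) (isAlgebraic_nat m) :=
      IntegralRep.ext' rfl (funext fun x => by simp)
    rw [e]
    simpa using h
  · have h := IntegralRep.of_constMul_nat_sub_nsmul_mem_relations r m
    -- `[σ, −m f] + [σ, m f] ∈ relations` by opposite integrands
    have hneg : of (r.constMul (m : ℝ) (isAlgebraic_nat m)) +
        of (r.constMul ((-(m : ℤ) : ℤ) : ℝ) (isAlgebraic_int (-(m : ℤ)))) ∈ relations :=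
      of_add_of_mem_relations_of_eqOn_neg rfl fun x _ => by simp
    have : of (r.constMul ((-(m : ℤ) : ℤ) : ℝ) (isAlgebraic_int (-(m : ℤ)))) - (-(m : ℤ)) • of r =
        (of (r.constMul (m : ℝ) (isAlgebraic_nat m)) +
          of (r.constMul ((-(m : ℤ) : ℤ) : ℝ) (isAlgebraic_int (-(m : ℤ))))) -
        (of (r.constMul (m : ℝ) (isAlgebraic_nat m)) - m • of r) := by
      simp only [neg_smul, natCast_zsmul]
      abel
    rw [this]
    exact relations.sub_mem hneg h

/-- **Splitting an integrand into an integer combination** (rule (1b) iterated): if `r` and the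
`R p` (`p ∈ L`, a list of (coefficient, representation) pairs) have a common domain on which
`r.integrand = Σ_{(k, R) ∈ L} k · R.integrand`, then `[r] − Σ k • [R] ∈ relations`.
[cite: KontsevichZagier2001, §1.2 rule (1)] -/
theorem of_sub_sum_zsmul_mem_relations {n : ℕ} {ι : Type*} (L : List ι) (k : ι → ℤ)
    (R : ι → IntegralRep n) (r : IntegralRep n) (hdom : ∀ i ∈ L, (R i).domain = r.domain)
    (h : EqOn r.integrand (fun x => (L.map fun i => (k i : ℝ) * (R i).integrand x).sum) r.domain) :
    of r - (L.map fun i => k i • of (R i)).sum ∈ relations := by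
  classical
  -- the scaled representations, indexed by positions
  set S : Fin L.length → IntegralRep n := fun j =>
    (R (L.get j)).constMul (k (L.get j) : ℝ) (isAlgebraic_int _) with hS
  have key : of r - ∑ j : Fin L.length, of (S j) ∈ relations := by
    refine of_sub_sum_integrand_mem_relations Finset.univ S r (fun j _ => ?_) (fun x hx => ?_)
    · simpa [hS] using hdom _ (List.get_mem L j)
    · rw [h hx]
      simp only [hS, IntegralRep.integrand_constMul]
      rw [← List.sum_ofFn]
      congr 1
      conv_lhs => rw [← List.ofFn_get L, List.map_ofFn]
      rfl
  have hsm : ∑ j : Fin L.length, (of (S j) - k (L.get j) • of (R (L.get j))) ∈ relations :=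
    sum_mem fun j _ => of_constMul_int_sub_zsmul_mem_relations _ _
  have hlist : (L.map fun i => k i • of (R i)).sum =
      ∑ j : Fin L.length, k (L.get j) • of (R (L.get j)) := by
    rw [← List.sum_ofFn]
    congr 1
    conv_lhs => rw [← List.ofFn_get L, List.map_ofFn]
    rfl
  rw [hlist]
  have : of r - ∑ j : Fin L.length, k (L.get j) • of (R (L.get j)) =
      (of r - ∑ j : Fin L.length, of (S j)) +
      ∑ j : Fin L.length, (of (S j) - k (L.get j) • of (R (L.get j))) := by
    rw [Finset.sum_sub_distrib]; abel
  rw [this]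
  exact relations.add_mem key hsm

/-! ## The domains in the literal shapes of the route -/

/-- `Δ₁ = (0, 1)`. [folklore] -/
theorem openOrderedSimplex_one :
    openOrderedSimplex 1 = {t : Fin 1 → ℝ | 0 < t 0 ∧ t 0 < 1} := by
  ext t
  simp only [openOrderedSimplex, mem_setOf_eq, Fin.forall_fin_one]
  constructor
  · rintro ⟨h0, h1, -⟩; exact ⟨h0, h1⟩
  · rintro ⟨h0, h1⟩; exact ⟨h0, h1, Subsingleton.strictAnti t⟩

/-- `Δ₂ = {1 > t₀ > t₁ > 0}`. [folklore] -/
theorem openOrderedSimplex_two :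
    openOrderedSimplex 2 = {t : Fin 2 → ℝ | 1 > t 0 ∧ t 0 > t 1 ∧ t 1 > 0} := by
  ext t
  simp only [openOrderedSimplex, mem_setOf_eq]
  constructor
  · rintro ⟨h0, h1, ha⟩
    exact ⟨h1 0, ha (show (0 : Fin 2) < 1 by decide), h0 1⟩
  · rintro ⟨h0, h01, h1⟩
    refine ⟨fun i => ?_, fun i => ?_, fun i j hij => ?_⟩
    · fin_cases i
      · show 0 < t 0; linarith
      · show 0 < t 1; linarith
    · fin_cases i
      · show t 0 < 1; linarith
      · show t 1 < 1; linarith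
    · fin_cases i <;> fin_cases j
      · exact absurd hij (lt_irrefl _)
      · show t 1 < t 0; linarith
      · exact absurd (Fin.lt_def.mp hij) (by decide)
      · exact absurd hij (lt_irrefl _)

/-- `Δ₃ = {1 > t₀ > t₁ > t₂ > 0}` (the literal domain of the crux). [folklore] -/
theorem openOrderedSimplex_three :
    openOrderedSimplex 3 = {t : Fin 3 → ℝ | 1 > t 0 ∧ t 0 > t 1 ∧ t 1 > t 2 ∧ t 2 > 0} := by
  ext t
  simp only [openOrderedSimplex, mem_setOf_eq]
  constructor
  · rintro ⟨h0, h1, ha⟩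
    exact ⟨h1 0, ha (show (0 : Fin 3) < 1 by decide), ha (show (1 : Fin 3) < 2 by decide), h0 2⟩
  · rintro ⟨h0, h01, h12, h2⟩
    refine ⟨fun i => ?_, fun i => ?_, fun i j hij => ?_⟩
    · fin_cases i
      · show 0 < t 0; linarith
      · show 0 < t 1; linarith
      · show 0 < t 2; linarith
    · fin_cases i
      · show t 0 < 1; linarith
      · show t 1 < 1; linarith
      · show t 2 < 1; linarith
    · have hij' := Fin.lt_def.mp hij
      fin_cases i <;> fin_cases j <;> simp at hij' ⊢ <;> linarith

/-- The product domain `(0,1) × Δ₂ ⊆ ℝ³` of a one-letter and a two-letter representation, in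
the literal shape of the route (`LevelFourStuffleInKZ`'s `P.domain`). [folklore] -/
theorem prodDomain_one_two (r : IntegralRep 1) (s : IntegralRep 2)
    (hr : r.domain = openOrderedSimplex 1) (hs : s.domain = openOrderedSimplex 2) :
    IntegralRep.prodDomain r s =
      {t : Fin 3 → ℝ | (0 < t 0 ∧ t 0 < 1) ∧ 1 > t 1 ∧ t 1 > t 2 ∧ t 2 > 0} := by
  ext t
  simp only [IntegralRep.prodDomain, hr, hs, openOrderedSimplex_one, openOrderedSimplex_two,
    mem_setOf_eq]
  rfl

end Summit.KontsevichZagierPeriods.OctahedralSymmetry.ZhaoRelationInKZ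

end


-- ===== inlined from ZhaoRelationInKZ.lean =====

/-!
# `ZhaoRelationInKZ` (stmt-KontsevichZagierPeriods-9433, route `OctahedralSymmetry`) — line `Sketch`:
SKELETON (word certificate over three regularisation-free engines)

The crux: the real and the imaginary parts of Zhao's non-standard weight-3 level-4 relation
`Σₖ cₖ I(Wₖ) = 0` [Zhao 2010, Rem. 10.1] are KZ relations.

LINE. In the free abelian group `KZ.FormalRep`, every RELATION FAMILY below delivers rows
`evalRow ρ ∈ KZ.relations` over the 160 symbols `Re I(W)`, `Im I(W)` (`W` the 80 convergent
weight-3 words):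
* (conj) `Re I(W̄) = Re I(W)`, `Im I(W̄) = −Im I(W)`, `Im I(W) = 0` for real words — integrand
  congruences (`stub_conj`);
* (σ) Zhao's octahedral involution at weight 3 — ONE change of variables
  (`OctahedralInvolutionMove`, PROVED in the tree) plus partial fractions (`stub_sigma`);
* (dil) the weight-2 distribution `t ↦ t²` (`SimplexDilationMove`, PROVED) plus partial fractions
  (`stub_dil2`), lifted by a weight-1 letter through the product ideal and the shuffle
  DISSECTION of `(0,1) × Δ₂` into three simplices (`stub_shuffle`) — glue `dilLift_rows`;
* (fds) the finite double shuffle block (1)×(1,1): the stuffle half is a six-term chain on the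
  open cube (two monomial-chart transports `stub_transportCubical`, `stub_transportSpectator`,
  two coordinate permutations, one pointwise partial fraction — `stub_stuffle`), the shuffle half
  is `stub_shuffle` — glue `fds_rows`.
The line's computation (lead session, `work/num/`): these rows have rank 150 (of the maximal 152)
and contain both parts of Zhao's combination; an explicit integer certificate with 152 rows
(10 fds-, 6 lifted-dilation-, 20 σ-instances, 46 free conjugation rows) and multiplier `N = 12`
is checked by `decide` (`certRe`, `certIm`), and `IntegerDivision` (PROVED) removes `N`.

Stubs: `stub_conj`, `stub_sigma`, `stub_dil2`, `stub_shuffle`, `stub_transportCubical`,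
`stub_transportSpectator`, `stub_stuffle`.  Composition: `ZhaoRelationInKZ_of`.
-/

noncomputable section

open Set MeasureTheory
open Literature.NumberTheory.Transcendental Literature.NumberTheory.Transcendental.KZ
open Summit.KontsevichZagierPeriods.KontsevichZagierPeriods.Theses.OctahedralSymmetry
  (ZhaoRelationInKZ OctahedralInvolutionMove SimplexDilationMove)

namespace Summit.KontsevichZagierPeriods.OctahedralSymmetry.ZhaoRelationInKZ

/-! ## Stubs

All stub statements are written over the tree's vocabulary only (`KZ.levelFourRepRe/Im`,
`KZ.IntegralRep.prod`, `KZ.of`, `KZ.relations`, `LevelFour.expand/sigmaLetter/dilLetter/conjWord`),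
so that each can land as a helper file before the line's definition file does; a "class function"
`Zr`/`Zi` in a stub is ANY function agreeing with the canonical classes on convergent words and
vanishing elsewhere (instantiated below with `Z false`/`Z true`). -/

/-- **Stub `stub_conj`** (free rows): complex conjugation of all letters conjugates the word
integrand pointwise, so `Re I(W̄) − Re I(W)`, `Im I(W̄) + Im I(W)` are integrand congruences
(rule (1b)), and a self-conjugate word has identically vanishing imaginary integrand; for a
non-convergent word everything is `0`. [folklore] -/
theorem stub_conj (Zr Zi : List (Fin 5) → FormalRep)
    (hZr : ∀ (W : List (Fin 5)) (h : LevelFour.IsConvergent W),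
      Zr W = of (levelFourRepRe W (integrableOn_levelFourIntegrandC h)))
    (hZr₀ : ∀ W : List (Fin 5), ¬ LevelFour.IsConvergent W → Zr W = 0)
    (hZi : ∀ (W : List (Fin 5)) (h : LevelFour.IsConvergent W),
      Zi W = of (levelFourRepIm W (integrableOn_levelFourIntegrandC h)))
    (hZi₀ : ∀ W : List (Fin 5), ¬ LevelFour.IsConvergent W → Zi W = 0)
    (m₀ m₁ m₂ : Fin 5) :
    Zr (LevelFour.conjWord [m₀, m₁, m₂]) - Zr [m₀, m₁, m₂] ∈ relations ∧
    Zi (LevelFour.conjWord [m₀, m₁, m₂]) + Zi [m₀, m₁, m₂] ∈ relations ∧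
    (LevelFour.conjWord [m₀, m₁, m₂] = [m₀, m₁, m₂] → Zi [m₀, m₁, m₂] ∈ relations) := by
  sorry

/-- **Stub `stub_sigma`** (engine σ, weight 3): for a convergent word `W = (m₀, m₁, m₂)` the
element `[W] + Σ_{(c,V) ∈ expand σ W} c·[reverse V]` (real parts, and imaginary parts) is a KZ
relation: ONE change of variables `t ↦ (σ t₂, σ t₁, σ t₀)` on `Δ₃` (`OctahedralInvolutionMove_of`,
|J| = ∏ 2/(1+tⱼ)²) followed by the letterwise partial fractions `σ^*ω_a = ω_{σa} − ω_{−1}`,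
`σ^*ω_{−1} = −ω_{−1}` and trilinear expansion (rule (1b)); every word in the expansion is convergent.
[cite: Zhao2008, §4] -/
theorem stub_sigma (Zr Zi : List (Fin 5) → FormalRep)
    (hZr : ∀ (W : List (Fin 5)) (h : LevelFour.IsConvergent W),
      Zr W = of (levelFourRepRe W (integrableOn_levelFourIntegrandC h)))
    (hZi : ∀ (W : List (Fin 5)) (h : LevelFour.IsConvergent W),
      Zi W = of (levelFourRepIm W (integrableOn_levelFourIntegrandC h)))
    (m₀ m₁ m₂ : Fin 5) (h₀ : m₀ ≠ 0) (h₂ : m₂ ≠ 4) :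
    Zr [m₀, m₁, m₂] + ((LevelFour.expand LevelFour.sigmaLetter [m₀, m₁, m₂]).map
        fun cV => cV.1 • Zr cV.2.reverse).sum ∈ relations ∧
    Zi [m₀, m₁, m₂] + ((LevelFour.expand LevelFour.sigmaLetter [m₀, m₁, m₂]).map
        fun cV => cV.1 • Zi cV.2.reverse).sum ∈ relations := by
  sorry

/-- **Stub `stub_dil2`** (engine dil, weight 2): for a level-2 word `U = (u₀, u₁)` (poles
`u₀ ∈ {−1, 0}`, `u₁ ∈ {1, −1}`) the order-preserving change of variables `t ↦ (t₀², t₁²)` on `Δ₂`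
(`simplexDilationMove_proof`, |J| = 4t₀t₁) followed by `2t dt/(t² − b) = dt/(t − √b) + dt/(t + √b)`
(rule (1b)) gives `Re I(U) ≡ Σ c Re I(V)`, `Im I(U) ≡ Σ c Im I(V)` over `expand dil U`; and
`Im I(U) ≡ 0` (a real word has identically vanishing imaginary integrand). [cite: Zhao2010, §5] -/
theorem stub_dil2 (Zr Zi : List (Fin 5) → FormalRep)
    (hZr : ∀ (W : List (Fin 5)) (h : LevelFour.IsConvergent W),
      Zr W = of (levelFourRepRe W (integrableOn_levelFourIntegrandC h)))
    (hZi : ∀ (W : List (Fin 5)) (h : LevelFour.IsConvergent W),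
      Zi W = of (levelFourRepIm W (integrableOn_levelFourIntegrandC h)))
    (u₀ u₁ : Fin 5) (hu₀ : u₀ = 2 ∨ u₀ = 4) (hu₁ : u₁ = 0 ∨ u₁ = 2) :
    Zr [u₀, u₁] - ((LevelFour.expand LevelFour.dilLetter [u₀, u₁]).map
        fun cV => cV.1 • Zr cV.2).sum ∈ relations ∧
    Zi [u₀, u₁] - ((LevelFour.expand LevelFour.dilLetter [u₀, u₁]).map
        fun cV => cV.1 • Zi cV.2).sum ∈ relations ∧
    Zi [u₀, u₁] ∈ relations := by
  sorry

/-- **Stub `stub_shuffle`** (shuffle (1)×(2) is a dissection): for a convergent letter `a` and a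
convergent two-letter word `(v₀, v₁)`, the complex product `I(a)·I(v₀,v₁)` — real part
`[R_a × R_V] − [J_a × J_V]`, imaginary part `[R_a × J_V] + [J_a × R_V]` of Fubini products on
`(0,1) × Δ₂` — is congruent to the three interleaved words: `(0,1) × Δ₂` is, off the null walls
`{t₀ = t₁}`, `{t₀ = t₂}`, the disjoint union of the cells `{t₀ > t₁}`, `{t₁ > t₀ > t₂}`, `{t₂ > t₀}`,
each a coordinate permutation of `Δ₃` (rules (1a), (2): `KZ.of_sub_sum_of_mem_relations`,
`KZ.of_sub_of_reindex_mem_relations`), and on each cell `Re(f_a F_V) = R_aR_V − J_aJ_V`,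
`Im(f_a F_V) = R_aJ_V + J_aR_V` (rule (1b)). [cite: Zhao2010, §2 Lemma 2.2] -/
theorem stub_shuffle (a v₀ v₁ : Fin 5) (ha : LevelFour.IsConvergent [a])
    (hv : LevelFour.IsConvergent [v₀, v₁]) (h₁ : LevelFour.IsConvergent [a, v₀, v₁])
    (h₂ : LevelFour.IsConvergent [v₀, a, v₁]) (h₃ : LevelFour.IsConvergent [v₀, v₁, a]) :
    of ((levelFourRepRe [a] (integrableOn_levelFourIntegrandC ha)).prod
          (levelFourRepRe [v₀, v₁] (integrableOn_levelFourIntegrandC hv)))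
      - of ((levelFourRepIm [a] (integrableOn_levelFourIntegrandC ha)).prod
          (levelFourRepIm [v₀, v₁] (integrableOn_levelFourIntegrandC hv)))
      - (of (levelFourRepRe [a, v₀, v₁] (integrableOn_levelFourIntegrandC h₁))
        + of (levelFourRepRe [v₀, a, v₁] (integrableOn_levelFourIntegrandC h₂))
        + of (levelFourRepRe [v₀, v₁, a] (integrableOn_levelFourIntegrandC h₃))) ∈ relations ∧
    of ((levelFourRepRe [a] (integrableOn_levelFourIntegrandC ha)).prod
          (levelFourRepIm [v₀, v₁] (integrableOn_levelFourIntegrandC hv)))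
      + of ((levelFourRepIm [a] (integrableOn_levelFourIntegrandC ha)).prod
          (levelFourRepRe [v₀, v₁] (integrableOn_levelFourIntegrandC hv)))
      - (of (levelFourRepIm [a, v₀, v₁] (integrableOn_levelFourIntegrandC h₁))
        + of (levelFourRepIm [v₀, a, v₁] (integrableOn_levelFourIntegrandC h₂))
        + of (levelFourRepIm [v₀, v₁, a] (integrableOn_levelFourIntegrandC h₃))) ∈ relations := by
  sorry

/-- **Stub `stub_transportCubical`** (rule (2), one move; verbatim the stub of the sibling crux
`LevelFourStuffleInKZ`): every representation on the literal ordered simplex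
`{1 > t₀ > t₁ > t₂ > 0}` has a pull-back to the open cube along the cumulative chart
`s ↦ (s₀, s₀s₁, s₀s₁s₂)` (Jacobian `s₀²s₁`), KZ-equivalent to it (`monomialChart_transport`).
[cite: KontsevichZagier2001, §1.2 rule (2)] -/
theorem stub_transportCubical (A : IntegralRep 3)
    (hA : A.domain = {t | 1 > t 0 ∧ t 0 > t 1 ∧ t 1 > t 2 ∧ t 2 > 0}) :
    ∃ At : IntegralRep 3, At.domain = {s | ∀ i, s i ∈ Set.Ioo (0:ℝ) 1} ∧
      (∀ s ∈ {s : Fin 3 → ℝ | ∀ i, s i ∈ Set.Ioo (0:ℝ) 1},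
        At.integrand s = A.integrand ![s 0, s 0 * s 1, s 0 * s 1 * s 2] * (s 0 ^ 2 * s 1)) ∧
      of At - of A ∈ relations := by
  sorry

/-- **Stub `stub_transportSpectator`** (rule (2), one move; verbatim the stub of the sibling crux
`LevelFourStuffleInKZ`): every representation on the literal product domain `(0,1) × Δ₂` has a
pull-back to the open cube along the spectator chart `s ↦ (s₀, s₁, s₁s₂)` (Jacobian `s₁`),
KZ-equivalent to it. [cite: KontsevichZagier2001, §1.2 rule (2)] -/
theorem stub_transportSpectator (P : IntegralRep 3)
    (hP : P.domain = {t | (0 < t 0 ∧ t 0 < 1) ∧ 1 > t 1 ∧ t 1 > t 2 ∧ t 2 > 0}) :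
    ∃ Pt : IntegralRep 3, Pt.domain = {s | ∀ i, s i ∈ Set.Ioo (0:ℝ) 1} ∧
      (∀ s ∈ {s : Fin 3 → ℝ | ∀ i, s i ∈ Set.Ioo (0:ℝ) 1},
        Pt.integrand s = P.integrand ![s 0, s 1, s 1 * s 2] * s 1) ∧
      of Pt - of P ∈ relations := by
  sorry

/-- **Stub `stub_stuffle`** (engine fds, the stuffle half of block (1)×(1,1)): for poles
`p = i^x ≠ 1`, `q = i^y ≠ 1`, `r = i^{y+z}` the complex product `I(p)·I(q, r)` is congruent to
`I(p,pq,pr) + I(q,pq,pr) + I(q,r,pr) − I(0,pq,pr) − I(q,0,pr)` (real parts, and imaginary parts,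
over class functions `Zr`, `Zi`): pull the product back to the open cube along the spectator chart
and the five words along the cumulative chart (`stub_transportSpectator`, `stub_transportCubical`),
permute the cube coordinates of the 2nd, 3rd, 5th word (`KZ.of_sub_of_reindex_mem_relations`), and
split the pointwise identity
`v/((u−p)(v−q)(vw−r)) = u²v/((u−p)(uv−pq)(uvw−pr)) + uv²/((v−q)(uv−pq)(uvw−pr))
 + v²w/((v−q)(vw−r)(uvw−pr)) − u²v/(u(uv−pq)(uvw−pr)) − uv²/((v−q)(uv)(uvw−pr))` (rule (1b)).
[cite: Zhao2010, §2 Def. 2.4] -/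
theorem stub_stuffle (Zr Zi : List (Fin 5) → FormalRep)
    (hZr : ∀ (W : List (Fin 5)) (h : LevelFour.IsConvergent W),
      Zr W = of (levelFourRepRe W (integrableOn_levelFourIntegrandC h)))
    (hZi : ∀ (W : List (Fin 5)) (h : LevelFour.IsConvergent W),
      Zi W = of (levelFourRepIm W (integrableOn_levelFourIntegrandC h)))
    (x y z : Fin 4) (hx : x ≠ 0) (hy : y ≠ 0)
    (ha : LevelFour.IsConvergent [Fin.castSucc x])
    (hv : LevelFour.IsConvergent [Fin.castSucc y, Fin.castSucc (y + z)]) :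
    of ((levelFourRepRe [Fin.castSucc x] (integrableOn_levelFourIntegrandC ha)).prod
          (levelFourRepRe [Fin.castSucc y, Fin.castSucc (y + z)] (integrableOn_levelFourIntegrandC hv)))
      - of ((levelFourRepIm [Fin.castSucc x] (integrableOn_levelFourIntegrandC ha)).prod
          (levelFourRepIm [Fin.castSucc y, Fin.castSucc (y + z)] (integrableOn_levelFourIntegrandC hv)))
      - (Zr [Fin.castSucc x, Fin.castSucc (x + y), Fin.castSucc (x + y + z)]
        + Zr [Fin.castSucc y, Fin.castSucc (x + y), Fin.castSucc (x + y + z)]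
        + Zr [Fin.castSucc y, Fin.castSucc (y + z), Fin.castSucc (x + y + z)]
        - Zr [4, Fin.castSucc (x + y), Fin.castSucc (x + y + z)]
        - Zr [Fin.castSucc y, 4, Fin.castSucc (x + y + z)]) ∈ relations ∧
    of ((levelFourRepRe [Fin.castSucc x] (integrableOn_levelFourIntegrandC ha)).prod
          (levelFourRepIm [Fin.castSucc y, Fin.castSucc (y + z)] (integrableOn_levelFourIntegrandC hv)))
      + of ((levelFourRepIm [Fin.castSucc x] (integrableOn_levelFourIntegrandC ha)).prod
          (levelFourRepRe [Fin.castSucc y, Fin.castSucc (y + z)] (integrableOn_levelFourIntegrandC hv)))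
      - (Zi [Fin.castSucc x, Fin.castSucc (x + y), Fin.castSucc (x + y + z)]
        + Zi [Fin.castSucc y, Fin.castSucc (x + y), Fin.castSucc (x + y + z)]
        + Zi [Fin.castSucc y, Fin.castSucc (y + z), Fin.castSucc (x + y + z)]
        - Zi [4, Fin.castSucc (x + y), Fin.castSucc (x + y + z)]
        - Zi [Fin.castSucc y, 4, Fin.castSucc (x + y + z)]) ∈ relations := by
  sorry

/-! ## The stubs in the line's vocabulary (`Z`, `ZP`) -/

/-- `Z false` agrees with the canonical real-part classes on convergent words. [folklore] -/
theorem Z_false_spec (W : List (Fin 5)) (h : LevelFour.IsConvergent W) :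
    Z false W = of (levelFourRepRe W (integrableOn_levelFourIntegrandC h)) := Z_eq_of false W h

/-- `Z true` agrees with the canonical imaginary-part classes on convergent words. [folklore] -/
theorem Z_true_spec (W : List (Fin 5)) (h : LevelFour.IsConvergent W) :
    Z true W = of (levelFourRepIm W (integrableOn_levelFourIntegrandC h)) := Z_eq_of true W h

/-- The product classes, unfolded to `levelFourRepRe/Im`. [folklore] -/
theorem ZP_spec (b b' : Bool) (U V : List (Fin 5)) (hU : LevelFour.IsConvergent U)
    (hV : LevelFour.IsConvergent V) :
    ZP b b' U V = of ((bif b then levelFourRepIm U (integrableOn_levelFourIntegrandC hU)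
        else levelFourRepRe U (integrableOn_levelFourIntegrandC hU)).prod
      (bif b' then levelFourRepIm V (integrableOn_levelFourIntegrandC hV)
        else levelFourRepRe V (integrableOn_levelFourIntegrandC hV))) := by
  rw [ZP_eq_of b b' U V hU hV]; cases b <;> cases b' <;> rfl

/-- σ-rows in the line's vocabulary (`stub_sigma` with `Zr = Z false`, `Zi = Z true`).
[cite: Zhao2008, §4] -/
theorem sigma_rows (m₀ m₁ m₂ : Fin 5) (h₀ : m₀ ≠ 0) (h₂ : m₂ ≠ 4) :
    evalRow (Row.re (sigmaTerms [m₀, m₁, m₂])) ∈ relations ∧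
    evalRow (Row.im (sigmaTerms [m₀, m₁, m₂])) ∈ relations := by
  obtain ⟨hre, him⟩ := stub_sigma (Z false) (Z true) Z_false_spec Z_true_spec m₀ m₁ m₂ h₀ h₂
  constructor
  · rw [evalRow_re]
    simpa [sigmaTerms, List.map_map, Function.comp_def] using hre
  · rw [evalRow_im]
    simpa [sigmaTerms, List.map_map, Function.comp_def] using him

/-- Conjugation rows in the line's vocabulary (`stub_conj` with `Z false`, `Z true`). [folklore] -/
theorem conj_rows (m₀ m₁ m₂ : Fin 5) :
    evalRow (Row.re (conjTermsRe [m₀, m₁, m₂])) ∈ relations ∧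
    evalRow (Row.im (conjTermsIm [m₀, m₁, m₂])) ∈ relations ∧
    (LevelFour.conjWord [m₀, m₁, m₂] = [m₀, m₁, m₂] →
      evalRow (Row.im (imZeroTerms [m₀, m₁, m₂])) ∈ relations) := by
  obtain ⟨hre, him, h0⟩ := stub_conj (Z false) (Z true) Z_false_spec (Z_eq_zero false)
    Z_true_spec (Z_eq_zero true) m₀ m₁ m₂
  refine ⟨?_, ?_, fun h => ?_⟩
  · rw [evalRow_re]
    simpa [conjTermsRe, sub_eq_add_neg] using hre
  · rw [evalRow_im]
    simpa [conjTermsIm] using him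
  · rw [evalRow_im]
    simpa [imZeroTerms] using h0 h

/-- Weight-2 dilation in the line's vocabulary (`stub_dil2` with `Z false`, `Z true`).
[cite: Zhao2010, §5] -/
theorem dil2_Z (u₀ u₁ : Fin 5) (hu₀ : u₀ = 2 ∨ u₀ = 4) (hu₁ : u₁ = 0 ∨ u₁ = 2) :
    Z false [u₀, u₁] -
        ((LevelFour.expand LevelFour.dilLetter [u₀, u₁]).map fun cV => cV.1 • Z false cV.2).sum
      ∈ relations ∧
    Z true [u₀, u₁] -
        ((LevelFour.expand LevelFour.dilLetter [u₀, u₁]).map fun cV => cV.1 • Z true cV.2).sum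
      ∈ relations ∧
    Z true [u₀, u₁] ∈ relations :=
  stub_dil2 (Z false) (Z true) Z_false_spec Z_true_spec u₀ u₁ hu₀ hu₁

/-- Shuffle (1)×(2) in the line's vocabulary (`stub_shuffle` over `ZP`, `Z`).
[cite: Zhao2010, §2 Lemma 2.2] -/
theorem shuffle_Z (a v₀ v₁ : Fin 5) (ha₀ : a ≠ 0) (ha₄ : a ≠ 4) (hv₀ : v₀ ≠ 0) (hv₁ : v₁ ≠ 4) :
    ZP false false [a] [v₀, v₁] - ZP true true [a] [v₀, v₁]
        - (Z false [a, v₀, v₁] + Z false [v₀, a, v₁] + Z false [v₀, v₁, a]) ∈ relations ∧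
    ZP false true [a] [v₀, v₁] + ZP true false [a] [v₀, v₁]
        - (Z true [a, v₀, v₁] + Z true [v₀, a, v₁] + Z true [v₀, v₁, a]) ∈ relations := by
  have ha : LevelFour.IsConvergent [a] := ⟨by simpa using ha₀, by simpa using ha₄⟩
  have hv : LevelFour.IsConvergent [v₀, v₁] := ⟨by simpa using hv₀, by simpa using hv₁⟩
  have h₁ : LevelFour.IsConvergent [a, v₀, v₁] := ⟨by simpa using ha₀, by simpa using hv₁⟩
  have h₂ : LevelFour.IsConvergent [v₀, a, v₁] := ⟨by simpa using hv₀, by simpa using hv₁⟩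
  have h₃ : LevelFour.IsConvergent [v₀, v₁, a] := ⟨by simpa using hv₀, by simpa using ha₄⟩
  obtain ⟨hre, him⟩ := stub_shuffle a v₀ v₁ ha hv h₁ h₂ h₃
  rw [ZP_spec _ _ _ _ ha hv, ZP_spec _ _ _ _ ha hv, Z_false_spec _ h₁, Z_false_spec _ h₂,
    Z_false_spec _ h₃, ZP_spec _ _ _ _ ha hv, ZP_spec _ _ _ _ ha hv, Z_true_spec _ h₁,
    Z_true_spec _ h₂, Z_true_spec _ h₃]
  exact ⟨hre, him⟩

/-- The stuffle (1)×(1,1) in the line's vocabulary (`stub_stuffle` over `ZP`, `Z`).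
[cite: Zhao2010, §2 Def. 2.4] -/
theorem stuffle_Z (x y z : Fin 4) (hx : x ≠ 0) (hy : y ≠ 0) :
    ZP false false [Fin.castSucc x] [Fin.castSucc y, Fin.castSucc (y + z)]
      - ZP true true [Fin.castSucc x] [Fin.castSucc y, Fin.castSucc (y + z)]
      - (Z false [Fin.castSucc x, Fin.castSucc (x + y), Fin.castSucc (x + y + z)]
        + Z false [Fin.castSucc y, Fin.castSucc (x + y), Fin.castSucc (x + y + z)]
        + Z false [Fin.castSucc y, Fin.castSucc (y + z), Fin.castSucc (x + y + z)]
        - Z false [4, Fin.castSucc (x + y), Fin.castSucc (x + y + z)]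
        - Z false [Fin.castSucc y, 4, Fin.castSucc (x + y + z)]) ∈ relations ∧
    ZP false true [Fin.castSucc x] [Fin.castSucc y, Fin.castSucc (y + z)]
      + ZP true false [Fin.castSucc x] [Fin.castSucc y, Fin.castSucc (y + z)]
      - (Z true [Fin.castSucc x, Fin.castSucc (x + y), Fin.castSucc (x + y + z)]
        + Z true [Fin.castSucc y, Fin.castSucc (x + y), Fin.castSucc (x + y + z)]
        + Z true [Fin.castSucc y, Fin.castSucc (y + z), Fin.castSucc (x + y + z)]
        - Z true [4, Fin.castSucc (x + y), Fin.castSucc (x + y + z)]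
        - Z true [Fin.castSucc y, 4, Fin.castSucc (x + y + z)]) ∈ relations := by
  have hc4 : ∀ m : Fin 4, Fin.castSucc m ≠ (4 : Fin 5) := fun m h => by
    have := congrArg Fin.val h; simp at this; omega
  have hcx : Fin.castSucc x ≠ 0 := fun h => hx (Fin.castSucc_injective _ (by simpa using h))
  have hcy : Fin.castSucc y ≠ 0 := fun h => hy (Fin.castSucc_injective _ (by simpa using h))
  have ha : LevelFour.IsConvergent [Fin.castSucc x] := ⟨by simpa using hcx, by simpa using hc4 x⟩
  have hv : LevelFour.IsConvergent [Fin.castSucc y, Fin.castSucc (y + z)] :=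
    ⟨by simpa using hcy, by simpa using hc4 _⟩
  obtain ⟨hre, him⟩ := stub_stuffle (Z false) (Z true) Z_false_spec Z_true_spec x y z hx hy ha hv
  rw [ZP_spec _ _ _ _ ha hv, ZP_spec _ _ _ _ ha hv, ZP_spec _ _ _ _ ha hv, ZP_spec _ _ _ _ ha hv]
  exact ⟨hre, him⟩

/-! ## Glue: lifted dilation rows and finite-double-shuffle rows -/

/-- The real part of a complex product of classes, expanded: for a letter `a` and a term list
over two-letter words, `Σ c (R_a×R_V − J_a×J_V)` is congruent to `Σ c Σ_{W ∈ a ш V} [Re W]`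
(shuffle dissection termwise). [cite: Zhao2010, §2 Lemma 2.2] -/
theorem shuffle_sum_re (a : Fin 5) (ha₀ : a ≠ 0) (ha₄ : a ≠ 4)
    (L : List (ℤ × List (Fin 5)))
    (hL : ∀ cV ∈ L, ∃ v₀ v₁ : Fin 5, cV.2 = [v₀, v₁] ∧ v₀ ≠ 0 ∧ v₁ ≠ 4) :
    (L.map fun cV => cV.1 • (ZP false false [a] cV.2 - ZP true true [a] cV.2)).sum -
      (L.map fun cV => ((shuffle12 a cV.2).map fun W => cV.1 • Z false W).sum).sum ∈ relations := by
  induction L with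
  | nil => simp [relations.zero_mem]
  | cons cV L ih =>
    obtain ⟨v₀, v₁, hV, hv₀, hv₁⟩ := hL cV (by simp)
    have h1 := (shuffle_Z a v₀ v₁ ha₀ ha₄ hv₀ hv₁).1
    have ih' := ih fun cV' h' => hL cV' (by simp [h'])
    rw [List.map_cons, List.sum_cons, List.map_cons, List.sum_cons, hV,
      show shuffle12 a [v₀, v₁] = [[a, v₀, v₁], [v₀, a, v₁], [v₀, v₁, a]] from rfl]
    simp only [List.map_cons, List.map_nil, List.sum_cons, List.sum_nil, add_zero]
    convert relations.add_mem (relations.zsmul_mem h1 cV.1) ih' using 1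
    simp only [smul_sub, smul_add]
    abel

/-- The imaginary part of a complex product of classes, expanded (shuffle dissection termwise).
[cite: Zhao2010, §2 Lemma 2.2] -/
theorem shuffle_sum_im (a : Fin 5) (ha₀ : a ≠ 0) (ha₄ : a ≠ 4)
    (L : List (ℤ × List (Fin 5)))
    (hL : ∀ cV ∈ L, ∃ v₀ v₁ : Fin 5, cV.2 = [v₀, v₁] ∧ v₀ ≠ 0 ∧ v₁ ≠ 4) :
    (L.map fun cV => cV.1 • (ZP false true [a] cV.2 + ZP true false [a] cV.2)).sum -
      (L.map fun cV => ((shuffle12 a cV.2).map fun W => cV.1 • Z true W).sum).sum ∈ relations := by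
  induction L with
  | nil => simp [relations.zero_mem]
  | cons cV L ih =>
    obtain ⟨v₀, v₁, hV, hv₀, hv₁⟩ := hL cV (by simp)
    have h1 := (shuffle_Z a v₀ v₁ ha₀ ha₄ hv₀ hv₁).2
    have ih' := ih fun cV' h' => hL cV' (by simp [h'])
    rw [List.map_cons, List.sum_cons, List.map_cons, List.sum_cons, hV,
      show shuffle12 a [v₀, v₁] = [[a, v₀, v₁], [v₀, a, v₁], [v₀, v₁, a]] from rfl]
    simp only [List.map_cons, List.map_nil, List.sum_cons, List.sum_nil, add_zero]
    convert relations.add_mem (relations.zsmul_mem h1 cV.1) ih' using 1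
    simp only [smul_sub, smul_add]
    abel

end Summit.KontsevichZagierPeriods.OctahedralSymmetry.ZhaoRelationInKZ

namespace Summit.KontsevichZagierPeriods.OctahedralSymmetry.ZhaoRelationInKZ

/-! ## Small list lemmas -/

/-- `Σ` over a `flatMap` is the iterated sum. [folklore] -/
theorem list_sum_flatMap {α M : Type*} [AddCommMonoid M] (l : List α) (f : α → List M) :
    (l.flatMap f).sum = (l.map fun a => (f a).sum).sum := by
  induction l with
  | nil => simp
  | cons a l ih => simp [List.flatMap_cons, List.sum_append, ih]

/-- Pulling a negation out of a list sum. [folklore] -/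
theorem list_sum_map_neg {α M : Type*} [AddCommGroup M] (l : List α) (f : α → M) :
    (l.map fun a => -f a).sum = -(l.map f).sum := by
  induction l with
  | nil => simp
  | cons a l ih => simp [ih]; abel

/-- A list sum of differences. [folklore] -/
theorem list_sum_map_sub {α M : Type*} [AddCommGroup M] (l : List α) (f g : α → M) :
    (l.map fun a => f a - g a).sum = (l.map f).sum - (l.map g).sum := by
  induction l with
  | nil => simp
  | cons a l ih => simp [ih]; abel

/-- A list sum of sums. [folklore] -/
theorem list_sum_map_add {α M : Type*} [AddCommMonoid M] (l : List α) (f g : α → M) :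
    (l.map fun a => f a + g a).sum = (l.map f).sum + (l.map g).sum := by
  induction l with
  | nil => simp
  | cons a l ih => simp [ih]; abel

/-- Left multiplication distributes over a list sum of scalar multiples in a ring. [folklore] -/
theorem mul_list_sum_map_zsmul {α : Type*} (l : List α) (x : FormalRep) (c : α → ℤ)
    (f : α → FormalRep) : x * (l.map fun a => c a • f a).sum = (l.map fun a => c a • (x * f a)).sum := by
  induction l with
  | nil => simp
  | cons a l ih => simp [mul_add, ih, mul_smul_comm]

/-- The second half of `dilLiftTerms`, evaluated: the `flatMap` of the negated expansion reads as an
iterated sum. [folklore] -/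
theorem sum_dilLift_tail (b : Bool) (a : Fin 5) (E : List (ℤ × List (Fin 5))) :
    ((E.flatMap fun cV => (shuffle12 a cV.2).map fun W => (-cV.1, W)).map
        fun p : ℤ × List (Fin 5) => p.1 • Z b p.2).sum =
      ((E.map fun cV => (-cV.1, cV.2)).map
        fun cV => ((shuffle12 a cV.2).map fun W => cV.1 • Z b W).sum).sum := by
  induction E with
  | nil => simp
  | cons cV E ih =>
    rw [List.flatMap_cons, List.map_append, List.sum_append, ih, List.map_cons, List.map_cons,
      List.sum_cons, List.map_map]
    rfl

/-! ## Glue: the lifted dilation rows -/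

/-- The letters produced by `expand dil` on a level-2 weight-2 word are two-letter words with a
convergent shape (first letter `∈ {i, −i, 0}`, last letter a pole `≠ 0`). [folklore] -/
theorem expand_dil_shape (u₀ u₁ : Fin 5) (hu₀ : u₀ = 2 ∨ u₀ = 4) (hu₁ : u₁ = 0 ∨ u₁ = 2) :
    ∀ cV ∈ LevelFour.expand LevelFour.dilLetter [u₀, u₁],
      ∃ v₀ v₁ : Fin 5, cV.2 = [v₀, v₁] ∧ v₀ ≠ 0 ∧ v₁ ≠ 4 := by
  rcases hu₀ with rfl | rfl <;> rcases hu₁ with rfl | rfl <;> decide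

/-- **Lifted dilation rows** (family dil of the certificate): for `a ∈ {i, −1, −i}` (letters
`1, 2, 3`) and a level-2 weight-2 word `U`, the rows `Row.re/Row.im (dilLiftTerms a U)` are KZ
relations — the weight-2 relation of `stub_dil2` multiplied by the classes of the letter `a`
(product ideal `KZ.of_mul_mem_relations`), real and imaginary parts of the complex product
recombined, and every product dissected by `stub_shuffle`. [cite: Zhao2010, §5] -/
theorem dilLift_rows (a u₀ u₁ : Fin 5) (ha₀ : a ≠ 0) (ha₄ : a ≠ 4) (hu₀ : u₀ = 2 ∨ u₀ = 4)
    (hu₁ : u₁ = 0 ∨ u₁ = 2) :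
    evalRow (Row.re (dilLiftTerms a [u₀, u₁])) ∈ relations ∧
    evalRow (Row.im (dilLiftTerms a [u₀, u₁])) ∈ relations := by
  obtain ⟨hre, him, him0⟩ := dil2_Z u₀ u₁ hu₀ hu₁
  have ha : LevelFour.IsConvergent [a] := by
    constructor <;> simpa using by assumption
  set E := LevelFour.expand LevelFour.dilLetter [u₀, u₁] with hE
  -- the term list `(1, U) :: (−c, V)…` over which the shuffle is applied
  set L : List (ℤ × List (Fin 5)) := (1, [u₀, u₁]) :: E.map fun cV => (-cV.1, cV.2) with hL_def
  have hLshape : ∀ cV ∈ L, ∃ v₀ v₁ : Fin 5, cV.2 = [v₀, v₁] ∧ v₀ ≠ 0 ∧ v₁ ≠ 4 := by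
    intro cV hcV
    simp only [hL_def, List.mem_cons, List.mem_map] at hcV
    rcases hcV with rfl | ⟨cV', h', rfl⟩
    · refine ⟨u₀, u₁, rfl, ?_, ?_⟩
      · rcases hu₀ with rfl | rfl <;> decide
      · rcases hu₁ with rfl | rfl <;> decide
    · exact expand_dil_shape u₀ u₁ hu₀ hu₁ cV' h'
  -- the rows, unfolded
  have hrow : ∀ b : Bool,
      evalRow ((if b then Row.im else Row.re) (dilLiftTerms a [u₀, u₁])) =
        (L.map fun cV => ((shuffle12 a cV.2).map fun W => cV.1 • Z b W).sum).sum := by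
    intro b
    have h1 : evalRow ((if b then Row.im else Row.re) (dilLiftTerms a [u₀, u₁])) =
        ((dilLiftTerms a [u₀, u₁]).map fun p => p.1 • Z b p.2).sum := by
      cases b
      · exact evalRow_re _
      · exact evalRow_im _
    rw [h1, dilLiftTerms, ← hE, List.map_append, List.sum_append, hL_def, List.map_cons,
      List.sum_cons, List.map_map, sum_dilLift_tail]
    congr 1
  -- the ideal step, real part: `Z_f[a]·ρ_re − Z_t[a]·ρ_im`
  have hIre : Z false [a] * (Z false [u₀, u₁] - (E.map fun cV => cV.1 • Z false cV.2).sum) -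
      Z true [a] * (Z true [u₀, u₁] - (E.map fun cV => cV.1 • Z true cV.2).sum) ∈ relations := by
    refine relations.sub_mem ?_ ?_
    · rw [Z_eq_of false [a] ha]; exact of_mul_mem_relations _ hre
    · rw [Z_eq_of true [a] ha]; exact of_mul_mem_relations _ him
  have hIim : Z false [a] * (Z true [u₀, u₁] - (E.map fun cV => cV.1 • Z true cV.2).sum) +
      Z true [a] * (Z false [u₀, u₁] - (E.map fun cV => cV.1 • Z false cV.2).sum) ∈ relations := by
    refine relations.add_mem ?_ ?_
    · rw [Z_eq_of false [a] ha]; exact of_mul_mem_relations _ him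
    · rw [Z_eq_of true [a] ha]; exact of_mul_mem_relations _ hre
  -- rewrite the ideal elements as the `L`-sums of `ZP`'s
  have eRe : Z false [a] * (Z false [u₀, u₁] - (E.map fun cV => cV.1 • Z false cV.2).sum) -
      Z true [a] * (Z true [u₀, u₁] - (E.map fun cV => cV.1 • Z true cV.2).sum) =
      (L.map fun cV => cV.1 • (ZP false false [a] cV.2 - ZP true true [a] cV.2)).sum := by
    simp only [hL_def, List.map_cons, List.sum_cons, List.map_map, Function.comp_def, one_smul,
      mul_sub, mul_list_sum_map_zsmul, ZP_eq_mul, neg_smul, smul_sub, list_sum_map_sub,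
      list_sum_map_neg]
    abel
  have eIm : Z false [a] * (Z true [u₀, u₁] - (E.map fun cV => cV.1 • Z true cV.2).sum) +
      Z true [a] * (Z false [u₀, u₁] - (E.map fun cV => cV.1 • Z false cV.2).sum) =
      (L.map fun cV => cV.1 • (ZP false true [a] cV.2 + ZP true false [a] cV.2)).sum := by
    simp only [hL_def, List.map_cons, List.sum_cons, List.map_map, Function.comp_def, one_smul,
      mul_sub, mul_list_sum_map_zsmul, ZP_eq_mul, neg_smul, smul_add, list_sum_map_add,
      list_sum_map_neg]
    abel
  constructor
  · have h := relations.sub_mem (eRe ▸ hIre) (shuffle_sum_re a ha₀ ha₄ L hLshape)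
    rw [sub_sub_cancel] at h
    have e := hrow false
    simp only [Bool.false_eq_true, if_false] at e
    rwa [e]
  · have h := relations.sub_mem (eIm ▸ hIim) (shuffle_sum_im a ha₀ ha₄ L hLshape)
    rw [sub_sub_cancel] at h
    have e := hrow true
    simp only [if_true] at e
    rwa [e]

/-! ## Glue: the finite double shuffle rows -/

/-- **Finite double shuffle rows, block (1)×(1,1)** (family fds of the certificate): for
`x ≠ 0`, `y ≠ 0` the rows `Row.re/Row.im (fdsTerms x y z)` — stuffle expansion minus shuffle
expansion of `I(i^x)·I(i^y, i^{y+z})` — are KZ relations (`stub_stuffle` minus `stub_shuffle`).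
[cite: Zhao2010, §2 (FDS)] -/
theorem fds_rows (x y z : Fin 4) (hx : x ≠ 0) (hy : y ≠ 0) :
    evalRow (Row.re (fdsTerms x y z)) ∈ relations ∧ evalRow (Row.im (fdsTerms x y z)) ∈ relations := by
  obtain ⟨hstR, hstI⟩ := stuffle_Z x y z hx hy
  have hcx : Fin.castSucc x ≠ 0 := fun h => hx (Fin.castSucc_injective _ (by simpa using h))
  have hcy : Fin.castSucc y ≠ 0 := fun h => hy (Fin.castSucc_injective _ (by simpa using h))
  have hc4 : ∀ m : Fin 4, Fin.castSucc m ≠ (4 : Fin 5) := fun m h => by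
    have := congrArg Fin.val h; simp at this; omega
  obtain ⟨hshR, hshI⟩ := shuffle_Z (Fin.castSucc x) (Fin.castSucc y) (Fin.castSucc (y + z))
    hcx (hc4 x) hcy (hc4 _)
  constructor
  · have h := relations.sub_mem hshR hstR
    rw [evalRow_re]
    simp only [fdsTerms, List.map_cons, List.map_nil, List.sum_cons, List.sum_nil, one_smul,
      neg_smul, add_zero]
    convert h using 1
    abel
  · have h := relations.sub_mem hshI hstI
    rw [evalRow_im]
    simp only [fdsTerms, List.map_cons, List.map_nil, List.sum_cons, List.sum_nil, one_smul,
      neg_smul, add_zero]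
    convert h using 1
    abel

/-! ## The rows of the certificate -/

/-- **Every row of the certificate is a KZ relation.** The row list (10 fds-, 6 lifted-dilation-,
20 σ-instances, each with its real and imaginary part; 34 conjugation pairs; 12 vanishing
imaginary parts of real words) is dispatched to `fds_rows`, `dilLift_rows`, `sigma_rows`,
`conj_rows`; the side conditions on the instance lists are decided. [cite: Zhao2010, Rem. 10.1] -/
theorem rows_mem : ∀ ρ ∈ ((([(1, 1, 0), (1, 1, 1), (1, 1, 2), (1, 1, 3), (1, 2, 0), (1, 2, 1), (1, 2, 2), (1, 2, 3), (1, 3, 1), (1, 3, 2)] : List (Fin 4 × Fin 4 × Fin 4)).flatMap fun t =>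
          [Row.re (fdsTerms t.1 t.2.1 t.2.2), Row.im (fdsTerms t.1 t.2.1 t.2.2)]) ++
      (([(2, 4, 0), (2, 4, 2), (3, 2, 0), (3, 2, 2), (3, 4, 0), (3, 4, 2)] : List (Fin 5 × Fin 5 × Fin 5)).flatMap fun t =>
          [Row.re (dilLiftTerms t.1 [t.2.1, t.2.2]), Row.im (dilLiftTerms t.1 [t.2.1, t.2.2])]) ++
      (([(2, 3, 3), (2, 4, 3), (3, 0, 3), (3, 1, 2), (3, 1, 3), (3, 2, 3), (3, 3, 1), (3, 3, 2), (3, 3, 3), (3, 4, 1), (3, 4, 2), (3, 4, 3), (4, 0, 2), (4, 0, 3), (4, 2, 2), (4, 2, 3), (4, 3, 0), (4, 3, 1), (4, 3, 2), (4, 3, 3)] : List (Fin 5 × Fin 5 × Fin 5)).flatMap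
          fun t => [Row.re (sigmaTerms [t.1, t.2.1, t.2.2]), Row.im (sigmaTerms [t.1, t.2.1, t.2.2])]) ++
      (([(1, 0, 0), (1, 0, 1), (1, 0, 2), (1, 0, 3), (1, 1, 0), (1, 1, 1), (1, 1, 2), (1, 1, 3), (1, 2, 0), (1, 2, 1), (1, 2, 2), (1, 2, 3), (1, 3, 0), (1, 3, 1), (1, 3, 2), (1, 3, 3), (1, 4, 0), (1, 4, 1), (1, 4, 2), (1, 4, 3), (2, 0, 1), (2, 1, 0), (2, 1, 1), (2, 1, 2), (2, 1, 3), (2, 2, 1), (2, 4, 1), (4, 0, 1), (4, 1, 0), (4, 1, 1), (4, 1, 2), (4, 1, 3), (4, 2, 1), (4, 4, 1)] : List (Fin 5 × Fin 5 × Fin 5)).flatMap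
          fun t => [Row.re (conjTermsRe [t.1, t.2.1, t.2.2]), Row.im (conjTermsIm [t.1, t.2.1, t.2.2])]) ++
      (([(2, 0, 0), (2, 0, 2), (2, 2, 0), (2, 2, 2), (2, 4, 0), (2, 4, 2), (4, 0, 0), (4, 0, 2), (4, 2, 0), (4, 2, 2), (4, 4, 0), (4, 4, 2)] : List (Fin 5 × Fin 5 × Fin 5)).map
          fun t => Row.im (imZeroTerms [t.1, t.2.1, t.2.2]))), evalRow ρ ∈ relations := by
  set_option maxRecDepth 4000 in
  have hfds : ∀ t ∈ ([(1, 1, 0), (1, 1, 1), (1, 1, 2), (1, 1, 3), (1, 2, 0), (1, 2, 1), (1, 2, 2), (1, 2, 3), (1, 3, 1), (1, 3, 2)] : List (Fin 4 × Fin 4 × Fin 4)), t.1 ≠ 0 ∧ t.2.1 ≠ 0 := by decide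
  set_option maxRecDepth 4000 in
  have hdil : ∀ t ∈ ([(2, 4, 0), (2, 4, 2), (3, 2, 0), (3, 2, 2), (3, 4, 0), (3, 4, 2)] : List (Fin 5 × Fin 5 × Fin 5)),
      (t.1 ≠ 0 ∧ t.1 ≠ 4) ∧ (t.2.1 = 2 ∨ t.2.1 = 4) ∧ (t.2.2 = 0 ∨ t.2.2 = 2) := by decide
  set_option maxRecDepth 4000 in
  have hsig : ∀ t ∈ ([(2, 3, 3), (2, 4, 3), (3, 0, 3), (3, 1, 2), (3, 1, 3), (3, 2, 3), (3, 3, 1), (3, 3, 2), (3, 3, 3), (3, 4, 1), (3, 4, 2), (3, 4, 3), (4, 0, 2), (4, 0, 3), (4, 2, 2), (4, 2, 3), (4, 3, 0), (4, 3, 1), (4, 3, 2), (4, 3, 3)] : List (Fin 5 × Fin 5 × Fin 5)), t.1 ≠ 0 ∧ t.2.2 ≠ 4 := by decide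
  set_option maxRecDepth 4000 in
  have himz : ∀ t ∈ ([(2, 0, 0), (2, 0, 2), (2, 2, 0), (2, 2, 2), (2, 4, 0), (2, 4, 2), (4, 0, 0), (4, 0, 2), (4, 2, 0), (4, 2, 2), (4, 4, 0), (4, 4, 2)] : List (Fin 5 × Fin 5 × Fin 5)),
      LevelFour.conjWord [t.1, t.2.1, t.2.2] = [t.1, t.2.1, t.2.2] := by decide
  intro ρ hρ
  simp only [List.mem_append, List.mem_flatMap, List.mem_map] at hρ
  simp only [List.mem_cons, List.mem_nil_iff, or_false] at hρ hfds hdil hsig himz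
  rcases hρ with ((((⟨t, ht, rfl | rfl⟩ | ⟨t, ht, rfl | rfl⟩) | ⟨t, ht, rfl | rfl⟩) |
    ⟨t, ht, rfl | rfl⟩) | ⟨t, ht, rfl⟩)
  · exact (fds_rows _ _ _ (hfds t ht).1 (hfds t ht).2).1
  · exact (fds_rows _ _ _ (hfds t ht).1 (hfds t ht).2).2
  · obtain ⟨⟨h1, h2⟩, h3, h4⟩ := hdil t ht
    exact (dilLift_rows _ _ _ h1 h2 h3 h4).1
  · obtain ⟨⟨h1, h2⟩, h3, h4⟩ := hdil t ht
    exact (dilLift_rows _ _ _ h1 h2 h3 h4).2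
  · exact (sigma_rows _ _ _ (hsig t ht).1 (hsig t ht).2).1
  · exact (sigma_rows _ _ _ (hsig t ht).1 (hsig t ht).2).2
  · exact (conj_rows _ _ _).1
  · exact (conj_rows _ _ _).2.1
  · exact (conj_rows _ _ _).2.2 (himz t ht)

/-! ## The certificate -/

/-- **The certificate, real part** (exact linear algebra of the line, `N = 12`, 68 non-zero
multipliers), checked by `decide`. [cite: Zhao2010, Rem. 10.1] -/
theorem certRe : certCheck [-840, 0, 114, 0, -246, 0, 24, 0, -300, 0, 1194, 0, -1260, 0, 1830, 0, -90, 0, -402, 0, -470, 0, -228, 0, 774, 0, -718, 0, 238, 0, 420, 0, -28, 0, -690, 0, 1842, 0, -2877, 0, -771, 0, 5822, 0, -2646, 0, 1421, 0, -2763, 0, 864, 0, 804, 0, -978, 0, -872, 0, 148, 0, -2980, 0, -718, 0, 716, 0, 420, 0, 1690, 0, 1596, 0, 0, 0, -1068, 0, 1266, 0, -774, 0, 1548, 0, 57, 0, 127, 0, 1210, 0, -258, 0, -5048, 0, 2080, 0, -1626, 0, 264, 0, -665, 0, 1827, 0, 1124, 0, 238, 0, 1818, 0, -1150, 0, -114,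 0, -690, 0, -3162, 0, 328, 0, 2536, 0, -1194, 0, 1018, 0, -126, 0, 90, 0, 716, 0, -216, 0, -260, 0, -840, 0, 432, 0, 0, 0, 0, 0, 0, 0, 0, 0, 0, 0, 0, 0, 0, 0] ((([(1, 1, 0), (1, 1, 1), (1, 1, 2), (1, 1, 3), (1, 2, 0), (1, 2, 1), (1, 2, 2), (1, 2, 3), (1, 3, 1), (1, 3, 2)] : List (Fin 4 × Fin 4 × Fin 4)).flatMap fun t =>
          [Row.re (fdsTerms t.1 t.2.1 t.2.2), Row.im (fdsTerms t.1 t.2.1 t.2.2)]) ++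
      (([(2, 4, 0), (2, 4, 2), (3, 2, 0), (3, 2, 2), (3, 4, 0), (3, 4, 2)] : List (Fin 5 × Fin 5 × Fin 5)).flatMap fun t =>
          [Row.re (dilLiftTerms t.1 [t.2.1, t.2.2]), Row.im (dilLiftTerms t.1 [t.2.1, t.2.2])]) ++
      (([(2, 3, 3), (2, 4, 3), (3, 0, 3), (3, 1, 2), (3, 1, 3), (3, 2, 3), (3, 3, 1), (3, 3, 2), (3, 3, 3), (3, 4, 1), (3, 4, 2), (3, 4, 3), (4, 0, 2), (4, 0, 3), (4, 2, 2), (4, 2, 3), (4, 3, 0), (4, 3, 1), (4, 3, 2), (4, 3, 3)] : List (Fin 5 × Fin 5 × Fin 5)).flatMap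
          fun t => [Row.re (sigmaTerms [t.1, t.2.1, t.2.2]), Row.im (sigmaTerms [t.1, t.2.1, t.2.2])]) ++
      (([(1, 0, 0), (1, 0, 1), (1, 0, 2), (1, 0, 3), (1, 1, 0), (1, 1, 1), (1, 1, 2), (1, 1, 3), (1, 2, 0), (1, 2, 1), (1, 2, 2), (1, 2, 3), (1, 3, 0), (1, 3, 1), (1, 3, 2), (1, 3, 3), (1, 4, 0), (1, 4, 1), (1, 4, 2), (1, 4, 3), (2, 0, 1), (2, 1, 0), (2, 1, 1), (2, 1, 2), (2, 1, 3), (2, 2, 1), (2, 4, 1), (4, 0, 1), (4, 1, 0), (4, 1, 1), (4, 1, 2), (4, 1, 3), (4, 2, 1), (4, 4, 1)] : List (Fin 5 × Fin 5 × Fin 5)).flatMap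
          fun t => [Row.re (conjTermsRe [t.1, t.2.1, t.2.2]), Row.im (conjTermsIm [t.1, t.2.1, t.2.2])]) ++
      (([(2, 0, 0), (2, 0, 2), (2, 2, 0), (2, 2, 2), (2, 4, 0), (2, 4, 2), (4, 0, 0), (4, 0, 2), (4, 2, 0), (4, 2, 2), (4, 4, 0), (4, 4, 2)] : List (Fin 5 × Fin 5 × Fin 5)).map
          fun t => Row.im (imZeroTerms [t.1, t.2.1, t.2.2]))) 12 (Row.re zhaoTerms) = true := by
  set_option maxRecDepth 4000 in decide

/-- **The certificate, imaginary part** (`N = 12`, 67 non-zero multipliers), checked by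
`decide`. [cite: Zhao2010, Rem. 10.1] -/
theorem certIm : certCheck [0, -114, 0, -38, 0, 38, 0, 48, 0, 44, 0, -54, 0, -16, 0, 22, 0, -86, 0, -84, 0, -1, 0, 17, 0, 38, 0, -30, 0, 54, 0, 48, 0, -110, 0, 52, 0, -52, 0, 0, 0, -16, 0, 58, 0, -106, 0, 22, 0, 106, 0, 48, 0, 2, 0, -4, 0, -85, 0, 140, 0, -115, 0, -26, 0, -37, 0, -16, 0, 119, 0, 20, 0, 0, 0, 90, 0, 132, 0, 38, 0, 76, 0, -748, 0, 54, 0, 46, 0, 42, 0, -20, 0, 104, 0, 98, 0, -32, 0, -44, 0, 0, 0, -92, 0, 54, 0, 100, 0, -26, 0, -38, 0, 46, 0, 70, 0, 66, 0, 24, 0, -54, 0, -14, 0, -34, 0, -86, 0, 37, 0, 216, 0, -3, 0, 96, 0, 82, 0, 0, 0, -98, 0, 0, 0, 0, 0, 0, 0, 0, 0, 0] ((([(1, 1, 0), (1, 1, 1), (1, 1, 2), (1, 1, 3), (1, 2, 0), (1, 2, 1), (1, 2, 2), (1, 2, 3), (1, 3, 1), (1, 3, 2)] : List (Fin 4 ×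 Fin 4 × Fin 4)).flatMap fun t =>
          [Row.re (fdsTerms t.1 t.2.1 t.2.2), Row.im (fdsTerms t.1 t.2.1 t.2.2)]) ++
      (([(2, 4, 0), (2, 4, 2), (3, 2, 0), (3, 2, 2), (3, 4, 0), (3, 4, 2)] : List (Fin 5 × Fin 5 × Fin 5)).flatMap fun t =>
          [Row.re (dilLiftTerms t.1 [t.2.1, t.2.2]), Row.im (dilLiftTerms t.1 [t.2.1, t.2.2])]) ++
      (([(2, 3, 3), (2, 4, 3), (3, 0, 3), (3, 1, 2), (3, 1, 3), (3, 2, 3), (3, 3, 1), (3, 3, 2), (3, 3, 3), (3, 4, 1), (3, 4, 2), (3, 4, 3), (4, 0, 2), (4, 0, 3), (4, 2, 2), (4, 2, 3), (4, 3, 0), (4, 3, 1), (4, 3, 2), (4, 3, 3)] : List (Fin 5 × Fin 5 × Fin 5)).flatMap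
          fun t => [Row.re (sigmaTerms [t.1, t.2.1, t.2.2]), Row.im (sigmaTerms [t.1, t.2.1, t.2.2])]) ++
      (([(1, 0, 0), (1, 0, 1), (1, 0, 2), (1, 0, 3), (1, 1, 0), (1, 1, 1), (1, 1, 2), (1, 1, 3), (1, 2, 0), (1, 2, 1), (1, 2, 2), (1, 2, 3), (1, 3, 0), (1, 3, 1), (1, 3, 2), (1, 3, 3), (1, 4, 0), (1, 4, 1), (1, 4, 2), (1, 4, 3), (2, 0, 1), (2, 1, 0), (2, 1, 1), (2, 1, 2), (2, 1, 3), (2, 2, 1), (2, 4, 1), (4, 0, 1), (4, 1, 0), (4, 1, 1), (4, 1, 2), (4, 1, 3), (4, 2, 1), (4, 4, 1)] : List (Fin 5 × Fin 5 × Fin 5)).flatMap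
          fun t => [Row.re (conjTermsRe [t.1, t.2.1, t.2.2]), Row.im (conjTermsIm [t.1, t.2.1, t.2.2])]) ++
      (([(2, 0, 0), (2, 0, 2), (2, 2, 0), (2, 2, 2), (2, 4, 0), (2, 4, 2), (4, 0, 0), (4, 0, 2), (4, 2, 0), (4, 2, 2), (4, 4, 0), (4, 4, 2)] : List (Fin 5 × Fin 5 × Fin 5)).map
          fun t => Row.im (imZeroTerms [t.1, t.2.1, t.2.2]))) 12 (Row.im zhaoTerms) = true := by
  set_option maxRecDepth 4000 in decide

/-- **Zhao's rows are KZ relations**: `evalRow (Row.re zhaoTerms)`, `evalRow (Row.im zhaoTerms)`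
lie in `KZ.relations` (certificate soundness `certCheck_sound`, the rows `rows_mem`, and
integer division by `12`). [cite: Zhao2010, Rem. 10.1] -/
theorem zhao_rows_mem :
    evalRow (Row.re zhaoTerms) ∈ relations ∧ evalRow (Row.im zhaoTerms) ∈ relations :=
  ⟨mem_relations_of_zsmul_mem (by norm_num) (certCheck_sound _ _ _ _ certRe rows_mem),
    mem_relations_of_zsmul_mem (by norm_num) (certCheck_sound _ _ _ _ certIm rows_mem)⟩

/-! ## From the canonical classes to the crux's literal representations -/

/-- A representation on the literal simplex whose integrand is the route's real-part formula for
the word `(L 0, L 1, L 2)` is congruent to the canonical class `Z false [L 0, L 1, L 2]`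
(same domain by `openOrderedSimplex_three`, same integrand by `levelFourProd_re_fin_three`;
rule (1b)). [folklore] -/
theorem of_sub_Z_re (L : Fin 3 → Fin 5) (hL : L 0 ≠ 0 ∧ L 2 ≠ 4) (R : IntegralRep 3)
    (hdom : R.domain = {t | 1 > t 0 ∧ t 0 > t 1 ∧ t 1 > t 2 ∧ t 2 > 0})
    (hint : EqOn R.integrand (fun t =>
      levelFourRe (L 0) (t 0) * levelFourRe (L 1) (t 1) * levelFourRe (L 2) (t 2) -
        levelFourRe (L 0) (t 0) * levelFourIm (L 1) (t 1) * levelFourIm (L 2) (t 2) -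
        levelFourIm (L 0) (t 0) * levelFourRe (L 1) (t 1) * levelFourIm (L 2) (t 2) -
        levelFourIm (L 0) (t 0) * levelFourIm (L 1) (t 1) * levelFourRe (L 2) (t 2)) R.domain) :
    of R - Z false [L 0, L 1, L 2] ∈ relations := by
  have hconv : LevelFour.IsConvergent [L 0, L 1, L 2] := ⟨by simpa using hL.1, by simpa using hL.2⟩
  rw [Z_eq_of false _ hconv]
  refine of_sub_of_mem_relations_of_eqOn ?_ (fun t ht => ?_)
  · rw [rep_domain, hdom]; exact openOrderedSimplex_three
  · rw [hint ht, rep_false_integrand_apply]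
    show _ = (levelFourProd [L 0, L 1, L 2].get t).re
    rw [levelFourProd_re_fin_three]
    rfl

/-- The imaginary-part twin of `of_sub_Z_re`. [folklore] -/
theorem of_sub_Z_im (L : Fin 3 → Fin 5) (hL : L 0 ≠ 0 ∧ L 2 ≠ 4) (J : IntegralRep 3)
    (hdom : J.domain = {t | 1 > t 0 ∧ t 0 > t 1 ∧ t 1 > t 2 ∧ t 2 > 0})
    (hint : EqOn J.integrand (fun t =>
      levelFourRe (L 0) (t 0) * levelFourRe (L 1) (t 1) * levelFourIm (L 2) (t 2) +
        levelFourRe (L 0) (t 0) * levelFourIm (L 1) (t 1) * levelFourRe (L 2) (t 2) +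
        levelFourIm (L 0) (t 0) * levelFourRe (L 1) (t 1) * levelFourRe (L 2) (t 2) -
        levelFourIm (L 0) (t 0) * levelFourIm (L 1) (t 1) * levelFourIm (L 2) (t 2)) J.domain) :
    of J - Z true [L 0, L 1, L 2] ∈ relations := by
  have hconv : LevelFour.IsConvergent [L 0, L 1, L 2] := ⟨by simpa using hL.1, by simpa using hL.2⟩
  rw [Z_eq_of true _ hconv]
  refine of_sub_of_mem_relations_of_eqOn ?_ (fun t ht => ?_)
  · rw [rep_domain, hdom]; exact openOrderedSimplex_three
  · rw [hint ht, rep_true_integrand_apply]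
    show _ = (levelFourProd [L 0, L 1, L 2].get t).im
    rw [levelFourProd_im_fin_three]
    rfl

/-! ## Composition -/

/-- **Composition `ZhaoRelationInKZ_of`**: the stubs imply the crux `ZhaoRelationInKZ`. Given the
route's data (the literal letter tables, the nine words and coefficients, and representations
`R k`, `J k` with the prescribed domains and integrands), each `[R k]` / `[J k]` is congruent to
the canonical class of its word (`of_sub_Z_re/im`), and `Σ cₖ • Z (Wₖ)` is `evalRow` of Zhao's
row, a KZ relation by `zhao_rows_mem`. [cite: Zhao2010, Rem. 10.1] -/
theorem ZhaoRelationInKZ_of : ZhaoRelationInKZ := by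
  intro re im hre him word coef hword hcoef R J hdom hR hJ
  subst hre him hword hcoef
  have hconv : ∀ k : Fin 9, (![![2, 4, 3], ![3, 3, 3], ![2, 0, 3], ![3, 2, 1], ![1, 4, 0], ![1, 3, 3],
      ![1, 1, 1], ![3, 2, 0], ![4, 1, 1]] : Fin 9 → Fin 3 → Fin 5) k 0 ≠ 0 ∧
      (![![2, 4, 3], ![3, 3, 3], ![2, 0, 3], ![3, 2, 1], ![1, 4, 0], ![1, 3, 3],
      ![1, 1, 1], ![3, 2, 0], ![4, 1, 1]] : Fin 9 → Fin 3 → Fin 5) k 2 ≠ 4 := by decide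
  obtain ⟨hZre, hZim⟩ := zhao_rows_mem
  constructor
  · -- real parts
    have hk : ∀ k : Fin 9, of (R k) - Z false [(![![2, 4, 3], ![3, 3, 3], ![2, 0, 3], ![3, 2, 1],
        ![1, 4, 0], ![1, 3, 3], ![1, 1, 1], ![3, 2, 0], ![4, 1, 1]] : Fin 9 → Fin 3 → Fin 5) k 0,
        (![![2, 4, 3], ![3, 3, 3], ![2, 0, 3], ![3, 2, 1], ![1, 4, 0], ![1, 3, 3], ![1, 1, 1],
          ![3, 2, 0], ![4, 1, 1]] : Fin 9 → Fin 3 → Fin 5) k 1,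
        (![![2, 4, 3], ![3, 3, 3], ![2, 0, 3], ![3, 2, 1], ![1, 4, 0], ![1, 3, 3], ![1, 1, 1],
          ![3, 2, 0], ![4, 1, 1]] : Fin 9 → Fin 3 → Fin 5) k 2] ∈ relations := fun k =>
      of_sub_Z_re _ (hconv k) (R k) (hdom k).1 (by simpa [levelFourRe_eq, levelFourIm_eq] using hR k)
    have hsum : ∑ k : Fin 9, (![-5, -46, 7, 13, 13, 1, -25, 8, 18] : Fin 9 → ℤ) k • (of (R k) -
        Z false [(![![2, 4, 3], ![3, 3, 3], ![2, 0, 3], ![3, 2, 1],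
        ![1, 4, 0], ![1, 3, 3], ![1, 1, 1], ![3, 2, 0], ![4, 1, 1]] : Fin 9 → Fin 3 → Fin 5) k 0,
        (![![2, 4, 3], ![3, 3, 3], ![2, 0, 3], ![3, 2, 1], ![1, 4, 0], ![1, 3, 3], ![1, 1, 1],
          ![3, 2, 0], ![4, 1, 1]] : Fin 9 → Fin 3 → Fin 5) k 1,
        (![![2, 4, 3], ![3, 3, 3], ![2, 0, 3], ![3, 2, 1], ![1, 4, 0], ![1, 3, 3], ![1, 1, 1],
          ![3, 2, 0], ![4, 1, 1]] : Fin 9 → Fin 3 → Fin 5) k 2]) ∈ relations :=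
      sum_mem fun k _ => relations.zsmul_mem (hk k) _
    simp only [smul_sub, Finset.sum_sub_distrib] at hsum
    have e : ∑ k : Fin 9, (![-5, -46, 7, 13, 13, 1, -25, 8, 18] : Fin 9 → ℤ) k •
        Z false [(![![2, 4, 3], ![3, 3, 3], ![2, 0, 3], ![3, 2, 1],
        ![1, 4, 0], ![1, 3, 3], ![1, 1, 1], ![3, 2, 0], ![4, 1, 1]] : Fin 9 → Fin 3 → Fin 5) k 0,
        (![![2, 4, 3], ![3, 3, 3], ![2, 0, 3], ![3, 2, 1], ![1, 4, 0], ![1, 3, 3], ![1, 1, 1],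
          ![3, 2, 0], ![4, 1, 1]] : Fin 9 → Fin 3 → Fin 5) k 1,
        (![![2, 4, 3], ![3, 3, 3], ![2, 0, 3], ![3, 2, 1], ![1, 4, 0], ![1, 3, 3], ![1, 1, 1],
          ![3, 2, 0], ![4, 1, 1]] : Fin 9 → Fin 3 → Fin 5) k 2] = evalRow (Row.re zhaoTerms) := by
      rw [evalRow_re]
      simp only [Fin.sum_univ_succ, Fin.sum_univ_zero, Matrix.cons_val_zero, Matrix.cons_val_succ,
        zhaoTerms, List.map_cons, List.map_nil, List.sum_cons, List.sum_nil]
      rfl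
    rw [e] at hsum
    have := relations.add_mem hsum hZre
    rwa [sub_add_cancel] at this
  · -- imaginary parts
    have hk : ∀ k : Fin 9, of (J k) - Z true [(![![2, 4, 3], ![3, 3, 3], ![2, 0, 3], ![3, 2, 1],
        ![1, 4, 0], ![1, 3, 3], ![1, 1, 1], ![3, 2, 0], ![4, 1, 1]] : Fin 9 → Fin 3 → Fin 5) k 0,
        (![![2, 4, 3], ![3, 3, 3], ![2, 0, 3], ![3, 2, 1], ![1, 4, 0], ![1, 3, 3], ![1, 1, 1],
          ![3, 2, 0], ![4, 1, 1]] : Fin 9 → Fin 3 → Fin 5) k 1,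
        (![![2, 4, 3], ![3, 3, 3], ![2, 0, 3], ![3, 2, 1], ![1, 4, 0], ![1, 3, 3], ![1, 1, 1],
          ![3, 2, 0], ![4, 1, 1]] : Fin 9 → Fin 3 → Fin 5) k 2] ∈ relations := fun k =>
      of_sub_Z_im _ (hconv k) (J k) (hdom k).2 (by simpa [levelFourRe_eq, levelFourIm_eq] using hJ k)
    have hsum : ∑ k : Fin 9, (![-5, -46, 7, 13, 13, 1, -25, 8, 18] : Fin 9 → ℤ) k • (of (J k) -
        Z true [(![![2, 4, 3], ![3, 3, 3], ![2, 0, 3], ![3, 2, 1],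
        ![1, 4, 0], ![1, 3, 3], ![1, 1, 1], ![3, 2, 0], ![4, 1, 1]] : Fin 9 → Fin 3 → Fin 5) k 0,
        (![![2, 4, 3], ![3, 3, 3], ![2, 0, 3], ![3, 2, 1], ![1, 4, 0], ![1, 3, 3], ![1, 1, 1],
          ![3, 2, 0], ![4, 1, 1]] : Fin 9 → Fin 3 → Fin 5) k 1,
        (![![2, 4, 3], ![3, 3, 3], ![2, 0, 3], ![3, 2, 1], ![1, 4, 0], ![1, 3, 3], ![1, 1, 1],
          ![3, 2, 0], ![4, 1, 1]] : Fin 9 → Fin 3 → Fin 5) k 2]) ∈ relations :=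
      sum_mem fun k _ => relations.zsmul_mem (hk k) _
    simp only [smul_sub, Finset.sum_sub_distrib] at hsum
    have e : ∑ k : Fin 9, (![-5, -46, 7, 13, 13, 1, -25, 8, 18] : Fin 9 → ℤ) k •
        Z true [(![![2, 4, 3], ![3, 3, 3], ![2, 0, 3], ![3, 2, 1],
        ![1, 4, 0], ![1, 3, 3], ![1, 1, 1], ![3, 2, 0], ![4, 1, 1]] : Fin 9 → Fin 3 → Fin 5) k 0,
        (![![2, 4, 3], ![3, 3, 3], ![2, 0, 3], ![3, 2, 1], ![1, 4, 0], ![1, 3, 3], ![1, 1, 1],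
          ![3, 2, 0], ![4, 1, 1]] : Fin 9 → Fin 3 → Fin 5) k 1,
        (![![2, 4, 3], ![3, 3, 3], ![2, 0, 3], ![3, 2, 1], ![1, 4, 0], ![1, 3, 3], ![1, 1, 1],
          ![3, 2, 0], ![4, 1, 1]] : Fin 9 → Fin 3 → Fin 5) k 2] = evalRow (Row.im zhaoTerms) := by
      rw [evalRow_im]
      simp only [Fin.sum_univ_succ, Fin.sum_univ_zero, Matrix.cons_val_zero, Matrix.cons_val_succ,
        zhaoTerms, List.map_cons, List.map_nil, List.sum_cons, List.sum_nil]
      rfl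
    rw [e] at hsum
    have := relations.add_mem hsum hZim
    rwa [sub_add_cancel] at this

end Summit.KontsevichZagierPeriods.OctahedralSymmetry.ZhaoRelationInKZ

end
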